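import Literature.MathematicalPhysics.QuantumFieldTheory.Balaban1983to89.Beta.ExpKernelCalculus

/-!
# `BalabanUV.Beta.FP.StencilMoments` — POLYNOMIAL WEIGHTS AGAINST EXPONENTIALLY BI-LOCALISED KERNELS: `(|s|₁+1)^k e^{−δ|s|₁} ≤ k!·e^{δ/2}·(2/δ)^k·e^{−(δ/2)|s|₁}`,
# weighted kernels stay bi-localised at half the rate, row totals of bi-localised kernels (road «FP», LEGS generic Taylor-pairing track, module (M); [folklore])

HONEST DEPENDENCY (page 1, mandatory): continuum YM on T⁴ ⇐ BetaPertH ∧ nine spine estimates (0/9 proved); BetaPertH ⇐ (D1) ∧ (D4) ∧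
CAP+tail; G-an2-4 gates asym, D1 and NE2/3/4.  HONEST FRAMING (cell contract, verbatim): «discharging `BetaPertH` makes Bałaban's UV
stability UNCONDITIONAL — a real constructive-QFT result; it is NOT the continuum limit and NOT the Clay problem.»  THIS MODULE is elementary
[folklore] analysis on `ℤ^D` over the tree's `ExpKernelCalculus` (`BiLoc`, `Zl`, `summable_exp_shift'`, `tsum_exp_shift'`); it asserts nothing about Bałaban's
objects, cites nothing, mints no `Prop` fact, 0 `def`, 0 sorry.  Value = the MOMENT half of the LEGS row of road FP's N7 (`REP-DESIGN.md` (P3)): the Taylor monomials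
of `FP/LatticeTaylorIndex` (weight class `(|s|₁+1)²`) and the cubic remainder weights are absorbed by the exponential localisation of the stencils, so every
smeared difference leg and every remainder sum of the pairing is an absolutely convergent lattice sum with an explicit constant.  NOT D1, NOT BetaPertH, NOT continuum,
NOT Clay.

WHAT IS HERE.
* §1 `pow_succ_mul_exp_le`: `(L+1)^k · e^{−2aL} ≤ (k!·e^{a}/a^k) · e^{−aL}` for `L ≥ 0`, `a > 0` (Mathlib `Real.pow_div_factorial_le_exp`); `summable_of_weight_exp`:
  `|g z| ≤ C·(|z−q|₁+1)^k·e^{−δ|z−q|₁}` ⟹ `g` summable, `Σ'|g| ≤ C·k!·e^{δ/2}·(2/δ)^k·Zl(δ/2)`;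
* §2 `biLoc_weight_snd` ∕ `biLoc_weight_fst`: a kernel bi-localised at `(p, q)` with rate `δ`, multiplied by a weight `φ` of the second (resp. first) variable with
  `|φ z| ≤ (|z − q|₁ + 1)^k`, is bi-localised at `(p, q)` with rate `δ/2` and constant `C · k! · e^{δ/2} · (2/δ)^k`;
* §3 row totals of a bi-localised kernel: `summable_row`, `abs_tsum_row_le` (`|Σ'_z K x z a b| ≤ C·Zl(δ)·e^{−δ|x−p|₁}`), `summable_abs_tsum_row`,
  `tsum_abs_tsum_row_le` (`Σ'_x |Σ'_z K x z a b| ≤ C·Zl(δ)²`).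
Unit `b2b-balaban-beta-d1-formalise-leaf-02` (gen 5).
-/

noncomputable section

namespace Summit.QuantumFields.BalabanUV.Beta.FP.StencilMoments

open Finset
open scoped BigOperators
open Literature.MathematicalPhysics.QuantumFieldTheory.Balaban1983to89
open Literature.MathematicalPhysics.QuantumFieldTheory.Balaban1983to89.Beta
open B12Sec2to5 (l1 l1_nonneg)
open ExpKernelCalculus (Site MKer BiLoc Zl Zl_pos summable_exp_shift summable_exp_shift' tsum_exp_shift tsum_exp_shift')

variable {D : ℕ} {F : Type*}

/-! ## §1 Polynomial weights against exponentials -/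

/-- [folklore] `(L+1)^k · e^{−2aL} ≤ (k!·e^{a}/a^k) · e^{−aL}` for `L ≥ 0`, `a > 0`. -/
theorem pow_succ_mul_exp_le (k : ℕ) {a L : ℝ} (ha : 0 < a) (hL : 0 ≤ L) :
    (L + 1) ^ k * Real.exp (-(2 * a) * L) ≤ ((k.factorial : ℝ) * Real.exp a / a ^ k) * Real.exp (-a * L) := by
  have hM : 0 ≤ a * (L + 1) := by positivity
  have h1 := Real.pow_div_factorial_le_exp (a * (L + 1)) hM k
  have hk : (0 : ℝ) < k.factorial := by exact_mod_cast Nat.factorial_pos k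
  have hak : 0 < a ^ k := pow_pos ha k
  -- `(L+1)^k ≤ k!/a^k · e^{a(L+1)}`
  have h2 : (L + 1) ^ k ≤ (k.factorial : ℝ) / a ^ k * Real.exp (a * (L + 1)) := by
    rw [mul_pow] at h1
    rw [div_mul_eq_mul_div, le_div_iff₀ hak]
    have := (div_le_iff₀ hk).mp h1
    nlinarith [this]
  have e : ((k.factorial : ℝ) * Real.exp a / a ^ k) * Real.exp (-a * L)
      = ((k.factorial : ℝ) / a ^ k * Real.exp (a * (L + 1))) * Real.exp (-(2 * a) * L) := by
    rw [show a * (L + 1) = a + a * L by ring, Real.exp_add]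
    have : Real.exp (a * L) * Real.exp (-(2 * a) * L) = Real.exp (-a * L) := by
      rw [← Real.exp_add]; congr 1; ring
    calc ((k.factorial : ℝ) * Real.exp a / a ^ k) * Real.exp (-a * L)
        = ((k.factorial : ℝ) / a ^ k * Real.exp a) * (Real.exp (a * L) * Real.exp (-(2 * a) * L)) := by rw [this]; ring
      _ = _ := by ring
  rw [e]
  exact mul_le_mul_of_nonneg_right h2 (Real.exp_pos _).le

/-- [folklore] The same with rate `δ = 2a`: `(L+1)^k · e^{−δL} ≤ (k!·e^{δ/2}·(2/δ)^k) · e^{−(δ/2)L}`. -/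
theorem pow_succ_mul_exp_le' (k : ℕ) {δ L : ℝ} (hδ : 0 < δ) (hL : 0 ≤ L) :
    (L + 1) ^ k * Real.exp (-δ * L) ≤ ((k.factorial : ℝ) * Real.exp (δ / 2) * (2 / δ) ^ k) * Real.exp (-(δ / 2) * L) := by
  have h := pow_succ_mul_exp_le k (a := δ / 2) (by positivity) hL
  rw [show 2 * (δ / 2) = δ by ring] at h
  refine h.trans (le_of_eq ?_)
  congr 1
  rw [div_eq_mul_inv, ← inv_pow, inv_div]


/-- **A POLYNOMIALLY WEIGHTED, EXPONENTIALLY DECAYING LATTICE FUNCTION IS SUMMABLE** (`|g z| ≤ C·(|z−q|₁+1)^k·e^{−δ|z−q|₁}`, `δ > 0`), with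
`Σ'_z |g z| ≤ C·(k!·e^{δ/2}·(2/δ)^k)·Zl(δ/2)`. [folklore] -/
theorem summable_of_weight_exp {q : Site D} {δ C : ℝ} (hδ : 0 < δ) (hC : 0 ≤ C) {k : ℕ} {g : Site D → ℝ}
    (hg : ∀ z, |g z| ≤ C * (l1 (z - q) + 1) ^ k * Real.exp (-δ * l1 (z - q))) :
    Summable g ∧ ∑' z, |g z| ≤ C * ((k.factorial : ℝ) * Real.exp (δ / 2) * (2 / δ) ^ k) * Zl D (δ / 2) := by
  have hb : ∀ z, |g z| ≤ C * ((k.factorial : ℝ) * Real.exp (δ / 2) * (2 / δ) ^ k) * Real.exp (-(δ / 2) * l1 (z - q)) := by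
    intro z
    refine (hg z).trans ?_
    rw [mul_assoc, mul_assoc]
    exact mul_le_mul_of_nonneg_left (pow_succ_mul_exp_le' k hδ (l1_nonneg (z - q))) hC
  have hs := (summable_exp_shift' (show 0 < δ / 2 by positivity) q).mul_left (C * ((k.factorial : ℝ) * Real.exp (δ / 2) * (2 / δ) ^ k))
  have hsum : Summable g := Summable.of_norm_bounded hs (fun z => by rw [Real.norm_eq_abs]; exact hb z)
  refine ⟨hsum, ?_⟩
  calc ∑' z, |g z| ≤ ∑' z, C * ((k.factorial : ℝ) * Real.exp (δ / 2) * (2 / δ) ^ k) * Real.exp (-(δ / 2) * l1 (z - q)) :=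
        hsum.abs.tsum_le_tsum hb hs
    _ = C * ((k.factorial : ℝ) * Real.exp (δ / 2) * (2 / δ) ^ k) * Zl D (δ / 2) := by rw [tsum_mul_left, tsum_exp_shift']

/-! ## §2 Weighted bi-localised kernels -/

/-- **A POLYNOMIAL WEIGHT ON THE SECOND VARIABLE KEEPS BI-LOCALISATION (half rate)**: `BiLoc K p q C δ`, `|φ z| ≤ (|z−q|₁+1)^k` ⟹
`BiLoc (φ(z)·K) p q (C·k!·e^{δ/2}·(2/δ)^k) (δ/2)`. [folklore] -/
theorem biLoc_weight_snd {K : MKer D F} {p q : Site D} {C δ : ℝ} (hK : BiLoc K p q C δ) (hδ : 0 < δ) {φ : Site D → ℝ} {k : ℕ}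
    (hφ : ∀ z, |φ z| ≤ (l1 (z - q) + 1) ^ k) :
    BiLoc (fun y z a b => φ z * K y z a b) p q (C * ((k.factorial : ℝ) * Real.exp (δ / 2) * (2 / δ) ^ k)) (δ / 2) := by
  intro y z a b
  have hC : 0 ≤ C := by
    have := hK p q a b
    have h1 : Real.exp (-δ * (l1 (p - p) + l1 (q - q))) = 1 := by simp [l1]
    rw [h1, mul_one] at this
    exact (abs_nonneg _).trans this
  have hLy := l1_nonneg (y - p)
  have hLz := l1_nonneg (z - q)
  rw [abs_mul]
  have h1 := hK y z a b
  have h2 := hφ z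
  have hw := pow_succ_mul_exp_le' k hδ hLz
  -- `|φ z|·|K| ≤ (L_z+1)^k · C e^{−δ(L_y+L_z)} = C e^{−δ L_y} · ((L_z+1)^k e^{−δ L_z}) ≤ C e^{−δ L_y} · κ e^{−(δ/2)L_z} ≤ Cκ e^{−(δ/2)(L_y+L_z)}`
  have h3 : |φ z| * |K y z a b| ≤ (l1 (z - q) + 1) ^ k * (C * Real.exp (-δ * (l1 (y - p) + l1 (z - q)))) :=
    mul_le_mul h2 h1 (abs_nonneg _) (by positivity)
  refine h3.trans ?_
  have e1 : (l1 (z - q) + 1) ^ k * (C * Real.exp (-δ * (l1 (y - p) + l1 (z - q))))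
      = C * Real.exp (-δ * l1 (y - p)) * ((l1 (z - q) + 1) ^ k * Real.exp (-δ * l1 (z - q))) := by
    rw [show -δ * (l1 (y - p) + l1 (z - q)) = -δ * l1 (y - p) + -δ * l1 (z - q) by ring, Real.exp_add]; ring
  rw [e1]
  have h4 : C * Real.exp (-δ * l1 (y - p)) * ((l1 (z - q) + 1) ^ k * Real.exp (-δ * l1 (z - q)))
      ≤ C * Real.exp (-δ * l1 (y - p)) * (((k.factorial : ℝ) * Real.exp (δ / 2) * (2 / δ) ^ k) * Real.exp (-(δ / 2) * l1 (z - q))) :=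
    mul_le_mul_of_nonneg_left hw (by positivity)
  refine h4.trans ?_
  have h5 : Real.exp (-δ * l1 (y - p)) ≤ Real.exp (-(δ / 2) * l1 (y - p)) :=
    Real.exp_le_exp.mpr (by nlinarith)
  have hκ : 0 ≤ (k.factorial : ℝ) * Real.exp (δ / 2) * (2 / δ) ^ k := by positivity
  calc C * Real.exp (-δ * l1 (y - p)) * (((k.factorial : ℝ) * Real.exp (δ / 2) * (2 / δ) ^ k) * Real.exp (-(δ / 2) * l1 (z - q)))
      ≤ C * Real.exp (-(δ / 2) * l1 (y - p)) * (((k.factorial : ℝ) * Real.exp (δ / 2) * (2 / δ) ^ k) * Real.exp (-(δ / 2) * l1 (z - q))) := by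
        gcongr
    _ = C * ((k.factorial : ℝ) * Real.exp (δ / 2) * (2 / δ) ^ k) * Real.exp (-(δ / 2) * (l1 (y - p) + l1 (z - q))) := by
        rw [show -(δ / 2) * (l1 (y - p) + l1 (z - q)) = -(δ / 2) * l1 (y - p) + -(δ / 2) * l1 (z - q) by ring, Real.exp_add]; ring

/-- **A POLYNOMIAL WEIGHT ON THE FIRST VARIABLE KEEPS BI-LOCALISATION (half rate).** [folklore] -/
theorem biLoc_weight_fst {K : MKer D F} {p q : Site D} {C δ : ℝ} (hK : BiLoc K p q C δ) (hδ : 0 < δ) {φ : Site D → ℝ} {k : ℕ}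
    (hφ : ∀ y, |φ y| ≤ (l1 (y - p) + 1) ^ k) :
    BiLoc (fun y z a b => φ y * K y z a b) p q (C * ((k.factorial : ℝ) * Real.exp (δ / 2) * (2 / δ) ^ k)) (δ / 2) := by
  -- transpose, weight the second variable, transpose back
  have hKt : BiLoc (fun z y b a => K y z a b) q p C δ := fun z y b a => by
    rw [add_comm]; exact hK y z a b
  have h := biLoc_weight_snd (F := F) hKt hδ hφ
  intro y z a b
  have := h z y b a
  rwa [add_comm] at this

/-! ## §3 Row totals of bi-localised kernels -/

section Rows

variable [Fintype F] {K : MKer D F} {p q : Site D} {C δ : ℝ}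

omit [Fintype F] in
/-- [folklore] The constant of a `BiLoc` bound is nonnegative once the fibre is inhabited. -/
theorem nonneg_of_biLoc (hK : BiLoc K p q C δ) (a : F) : 0 ≤ C := hK.nonneg a

omit [Fintype F] in
/-- [folklore] Every row of a bi-localised kernel (`δ > 0`) is summable. -/
theorem summable_row (hK : BiLoc K p q C δ) (hδ : 0 < δ) (x : Site D) (a b : F) : Summable fun z => K x z a b := by
  refine Summable.of_norm_bounded ((summable_exp_shift' hδ q).mul_left (C * Real.exp (-δ * l1 (x - p)))) (fun z => ?_)
  rw [Real.norm_eq_abs]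
  refine (hK x z a b).trans (le_of_eq ?_)
  rw [show -δ * (l1 (x - p) + l1 (z - q)) = -δ * l1 (x - p) + -δ * l1 (z - q) by ring, Real.exp_add]; ring

omit [Fintype F] in
/-- **ROW TOTALS OF A BI-LOCALISED KERNEL DECAY FROM THE FIRST CENTRE**: `|Σ'_z K x z a b| ≤ C·Zl(δ)·e^{−δ|x−p|₁}`. [folklore] -/
theorem abs_tsum_row_le (hK : BiLoc K p q C δ) (hδ : 0 < δ) (x : Site D) (a b : F) :
    |∑' z, K x z a b| ≤ C * Zl D δ * Real.exp (-δ * l1 (x - p)) := by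
  have hs := (summable_exp_shift' hδ q).mul_left (C * Real.exp (-δ * l1 (x - p)))
  have hb := tsum_of_norm_bounded hs.hasSum (fun z => by
    rw [Real.norm_eq_abs]
    refine (hK x z a b).trans (le_of_eq ?_)
    rw [show -δ * (l1 (x - p) + l1 (z - q)) = -δ * l1 (x - p) + -δ * l1 (z - q) by ring, Real.exp_add]; ring)
  rw [Real.norm_eq_abs] at hb
  refine hb.trans (le_of_eq ?_)
  rw [tsum_mul_left, tsum_exp_shift']; ring

omit [Fintype F] in
/-- [folklore] The row totals are absolutely summable over the row index. -/
theorem summable_abs_tsum_row (hK : BiLoc K p q C δ) (hδ : 0 < δ) (a b : F) : Summable fun x => |∑' z, K x z a b| := by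
  refine Summable.of_nonneg_of_le (fun _ => abs_nonneg _) (fun x => abs_tsum_row_le hK hδ x a b) ?_
  exact (summable_exp_shift' hδ p).mul_left (C * Zl D δ)

omit [Fintype F] in
/-- [folklore] The row totals are summable over the row index. -/
theorem summable_tsum_row (hK : BiLoc K p q C δ) (hδ : 0 < δ) (a b : F) : Summable fun x => ∑' z, K x z a b :=
  (summable_abs_tsum_row hK hδ a b).of_abs

omit [Fintype F] in
/-- **THE DOUBLE TOTAL**: `Σ'_x |Σ'_z K x z a b| ≤ C·Zl(δ)²`. [folklore] -/
theorem tsum_abs_tsum_row_le (hK : BiLoc K p q C δ) (hδ : 0 < δ) (a b : F) :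
    ∑' x, |∑' z, K x z a b| ≤ C * Zl D δ ^ 2 := by
  have hs := (summable_exp_shift' hδ p).mul_left (C * Zl D δ)
  calc ∑' x, |∑' z, K x z a b| ≤ ∑' x, C * Zl D δ * Real.exp (-δ * l1 (x - p)) :=
        (summable_abs_tsum_row hK hδ a b).tsum_le_tsum (fun x => abs_tsum_row_le hK hδ x a b) hs
    _ = C * Zl D δ ^ 2 := by rw [tsum_mul_left, tsum_exp_shift']; ring

end Rows

end Summit.QuantumFields.BalabanUV.Beta.FP.StencilMoments

end
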